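import Summits.Parity.GeneralizedHardyLittlewood.Theorems.BeyondDiagonalBeatsQuarter.OffDiagPoissonTwistedSmooth
import HarnessLib

/-!
# Route `PrimeLevelFamEdge`, crux K_B (stmt-Parity-20343), line `diagonal_kernel_split` rev 4, plan Ω,
# sub-line **Ω-e (principal part, first lemma; OMEGA-BLUEPRINT L6) — COMPLETE `s`-SUMS RE-DISCRETISE:
# `Σ_{s∈ℤ} Φ̂(ξ₁, s/h + τ) = h·Σ_{k∈ℤ} e(−τkh)·𝓕₁Φ(ξ₁; kh)`, and the complete sum VANISHES when `h` exceeds the box**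

After the divisor switch (`OffDiagDivisorSwitch`: `h₂ = (αβ + qcs)/h₁`, i.e. the second dual frequency is
`ξ₂ = s/h₁ + τ`, `τ = αβ/(qch₁)`) the PRINCIPAL part of the class count (GATE G1 §4 (v) / G2 §(a) a8P, C2) carries the
COMPLETE `s`-sum of the box transform at fixed `(h₁, ξ₁)`. Poisson summation, applied backwards in the second variable,
evaluates it exactly:

* `ker_mul_fourierChar_neg`, `fourier_modulate` — modulation: `𝓕(e(−τ·)F)(ξ) = 𝓕F(ξ + τ)`;
* `tendsto_add_const_cocompact`, `isBigO_rpow_neg_two_shift`, `fourier_modulate_isBigO` — the decay `O(|ξ|⁻²)` survives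
  the shift;
* **`tsum_fourier_shift_eq`** — for `F` continuous of compact support with `𝓕F = O(|ξ|⁻²)`, `h ≥ 1`, `τ ∈ ℝ`:
  `Σ_{s∈ℤ} 𝓕F(s/h + τ) = h·Σ_{k∈ℤ} e(−τhk)·F(hk)`;
* **`tsum_fourier2_shift_eq`** — for `uncurry Φ` smooth of compact support:
  `Σ_{s∈ℤ} fourier2 Φ ξ₁ (s/h + τ) = h·Σ_{k∈ℤ} e(−τhk)·𝓕(t₁ ↦ Φ(t₁, hk))(ξ₁)` (swap the variables: `fourier2 Φ ξ₁ ξ₂` is the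
  transform in `t₂` of `t₂ ↦ 𝓕(Φ(·,t₂))(ξ₁)`, FI `fourier2_eq_swap`);
* **`tsum_fourier2_shift_eq_zero`** — if `Φ(t₁,t₂) = 0` unless `0 < t₂ < h` (e.g. a dyadic box weight with `2K₂ ≤ h`), the
  complete `s`-sum is `0`: only `k = 0` could contribute and `Φ(·,0) = 0`. This is the kernel form of «`Σ_s Φ_c = 0`»
  (G1 §4 (v)) for the large dual moduli.

Folklore Fourier analysis over the tree's toolkit (`FriedlanderIwaniecPrimes.tsum_arithProg_eq_tsum_fourier_of_decay`,
`fourier_sliceFourier_isBigO`; prover-2's `OffDiagPoissonTwisted.poissonHypotheses_of_contDiff`); theorems only; standard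
axioms. Helper toward `stub_offDiagBelowSlack_io`; closes nothing.
«The programme SEARCHES and TYPES; no claim about Landau–Siegel zeros, Theorems 1–2 of arXiv:2211.02515 or
a repaired Margin232 until a kernel theorem says so.»
-/

noncomputable section

open Real MeasureTheory Filter Complex Set
open scoped FourierTransform Topology ContDiff

namespace Summit.Parity.GeneralizedHardyLittlewood.Theorems.BeyondDiagonalBeatsQuarter.OffDiag

open Literature.NumberTheory.Sieve.FriedlanderIwaniecPrimes
open OffDiagPoissonTwisted (poissonHypotheses_of_contDiff)

/-! ### Modulation -/

/-- `e(−vξ)·e(−τv) = e(−v(ξ+τ))` for the Fourier kernel. [folklore] -/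
theorem ker_mul_fourierChar_neg (v ξ τ : ℝ) :
    Literature.NumberTheory.Sieve.FriedlanderIwaniecPrimes.ker v ξ * (𝐞 (-(τ * v)) : ℂ) = Literature.NumberTheory.Sieve.FriedlanderIwaniecPrimes.ker v (ξ + τ) := by
  rw [Literature.NumberTheory.Sieve.FriedlanderIwaniecPrimes.ker, Literature.NumberTheory.Sieve.FriedlanderIwaniecPrimes.ker, Real.fourierChar_apply, ← Complex.exp_add]
  congr 1
  push_cast
  ring

/-- **Modulation**: `𝓕(t ↦ e(−τt)·F(t))(ξ) = 𝓕F(ξ + τ)`. [folklore] -/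
theorem fourier_modulate (F : ℝ → ℂ) (τ ξ : ℝ) :
    𝓕 (fun t : ℝ ↦ (𝐞 (-(τ * t)) : ℂ) * F t) ξ = 𝓕 F (ξ + τ) := by
  rw [fourier_eq_integral_ker, fourier_eq_integral_ker]
  refine integral_congr_ae (Eventually.of_forall fun v ↦ ?_)
  simp only
  rw [← mul_assoc, ker_mul_fourierChar_neg]

/-- `ξ ↦ ξ + τ` tends to infinity with `ξ`. [folklore] -/
theorem tendsto_add_const_cocompact (τ : ℝ) : Tendsto (fun ξ : ℝ ↦ ξ + τ) (cocompact ℝ) (cocompact ℝ) := by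
  rw [cocompact_eq_atBot_atTop]
  exact ((tendsto_atBot_add_const_right _ τ tendsto_id).mono_right le_sup_left).sup
    ((tendsto_atTop_add_const_right _ τ tendsto_id).mono_right le_sup_right)

/-- `|ξ + τ|⁻² = O(|ξ|⁻²)` at infinity. [folklore] -/
theorem isBigO_rpow_neg_two_shift (τ : ℝ) :
    (fun ξ : ℝ ↦ |ξ + τ| ^ (-2 : ℝ)) =O[cocompact ℝ] fun ξ : ℝ ↦ |ξ| ^ (-2 : ℝ) := by
  refine Asymptotics.IsBigO.of_bound 4 ?_
  rw [cocompact_eq_atBot_atTop]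
  have key : ∀ ξ : ℝ, 2 * |τ| + 1 ≤ |ξ| → ‖|ξ + τ| ^ (-2 : ℝ)‖ ≤ 4 * ‖|ξ| ^ (-2 : ℝ)‖ := by
    intro ξ hξ
    have hξ0 : 0 < |ξ| := by linarith [abs_nonneg τ]
    have h1 : |ξ| / 2 ≤ |ξ + τ| := by
      have := abs_add_le (ξ + τ) (-τ)   -- |ξ| ≤ |ξ+τ| + |τ|
      rw [add_neg_cancel_right, abs_neg] at this
      linarith
    have h2 : 0 < |ξ + τ| := by linarith
    rw [Real.norm_of_nonneg (Real.rpow_nonneg (abs_nonneg _) _),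
      Real.norm_of_nonneg (Real.rpow_nonneg (abs_nonneg _) _),
      Real.rpow_neg (abs_nonneg _), Real.rpow_neg (abs_nonneg _), Real.rpow_two, Real.rpow_two]
    rw [show (4 : ℝ) * (|ξ| ^ 2)⁻¹ = ((|ξ| / 2) ^ 2)⁻¹ by field_simp; ring]
    exact inv_anti₀ (by positivity) (by nlinarith)
  refine Filter.Eventually.filter_mono le_rfl ?_
  rw [Filter.eventually_sup]
  constructor
  · filter_upwards [eventually_le_atBot (-(2 * |τ| + 1))] with ξ hξ
    exact key ξ (by rw [abs_of_neg (show ξ < 0 by linarith [abs_nonneg τ])]; linarith)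
  · filter_upwards [eventually_ge_atTop (2 * |τ| + 1)] with ξ hξ
    exact key ξ (by rw [abs_of_pos (show 0 < ξ by linarith [abs_nonneg τ])]; linarith)

/-- The decay `𝓕F = O(|ξ|⁻²)` survives modulation. [folklore] -/
theorem fourier_modulate_isBigO {F : ℝ → ℂ} (hdec : 𝓕 F =O[cocompact ℝ] fun ξ : ℝ ↦ |ξ| ^ (-2 : ℝ)) (τ : ℝ) :
    𝓕 (fun t : ℝ ↦ (𝐞 (-(τ * t)) : ℂ) * F t) =O[cocompact ℝ] fun ξ : ℝ ↦ |ξ| ^ (-2 : ℝ) := by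
  have heq : 𝓕 (fun t : ℝ ↦ (𝐞 (-(τ * t)) : ℂ) * F t) = fun ξ ↦ 𝓕 F (ξ + τ) :=
    funext fun ξ ↦ fourier_modulate F τ ξ
  rw [heq]
  exact (hdec.comp_tendsto (tendsto_add_const_cocompact τ)).trans (isBigO_rpow_neg_two_shift τ)

/-! ### Complete sums of a Fourier transform along a shifted lattice -/

/-- **Complete shifted lattice sums re-discretise**: for `F` continuous of compact support with `𝓕F = O(|ξ|⁻²)`,
`h ≥ 1` and `τ ∈ ℝ`: `Σ_{s∈ℤ} 𝓕F(s/h + τ) = h·Σ_{k∈ℤ} e(−τhk)·F(hk)` (Poisson summation for `e(−τ·)F` along `hℤ`).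
[folklore] -/
theorem tsum_fourier_shift_eq {F : ℝ → ℂ} (hFc : Continuous F) (hFs : HasCompactSupport F)
    (hdec : 𝓕 F =O[cocompact ℝ] fun ξ : ℝ ↦ |ξ| ^ (-2 : ℝ)) {h : ℕ} (hh : 0 < h) (τ : ℝ) :
    ∑' s : ℤ, 𝓕 F ((s : ℝ) / h + τ) = (h : ℂ) * ∑' k : ℤ, (𝐞 (-(τ * (h * k))) : ℂ) * F (h * k) := by
  set G : ℝ → ℂ := fun t ↦ (𝐞 (-(τ * t)) : ℂ) * F t with hG
  have hchar : Continuous fun t : ℝ ↦ ((𝐞 (-(τ * t)) : ℂ)) := by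
    have heq : (fun t : ℝ ↦ ((𝐞 (-(τ * t)) : ℂ))) = fun t : ℝ ↦ Complex.exp (↑(2 * π * (-(τ * t))) * Complex.I) :=
      funext fun t ↦ Real.fourierChar_apply _
    rw [heq]
    fun_prop
  have hGc : Continuous G := hchar.mul hFc
  have hGs : HasCompactSupport G := hFs.mul_left
  have hP := tsum_arithProg_eq_tsum_fourier_of_decay hGc hGs (fourier_modulate_isBigO hdec τ) hh 0
  simp only [Int.cast_zero, zero_add, zero_mul, zero_div, AddChar.map_zero_eq_one, Circle.coe_one,
    one_mul] at hP
  -- `hP : Σ' m, G (h m) = h⁻¹ Σ' k, 𝓕 G (k/h)`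
  have hh0 : (h : ℂ) ≠ 0 := by exact_mod_cast hh.ne'
  have h2 : ∑' k : ℤ, 𝓕 G ((k : ℝ) / h) = (h : ℂ) * ∑' m : ℤ, G (h * m) := by
    rw [hP, ← mul_assoc, mul_inv_cancel₀ hh0, one_mul]
  simp only [hG, fourier_modulate] at h2
  exact h2

/-! ### Complete `s`-sums of the two-dimensional box transform -/

section TwoDim

variable {Φ : ℝ → ℝ → ℂ}

/-- Swapping the variables preserves smoothness. [folklore] -/
theorem contDiff_uncurry_swap (hΦ : ContDiff ℝ ∞ (Function.uncurry Φ)) :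
    ContDiff ℝ ∞ (Function.uncurry fun t₂ t₁ ↦ Φ t₁ t₂) := by
  have : (Function.uncurry fun t₂ t₁ ↦ Φ t₁ t₂) = Function.uncurry Φ ∘ Prod.swap := by
    funext p; rfl
  rw [this]
  exact hΦ.comp (contDiff_snd.prodMk contDiff_fst)

/-- Swapping the variables preserves compact support. [folklore] -/
theorem hasCompactSupport_uncurry_swap (hΦc : HasCompactSupport (Function.uncurry Φ)) :
    HasCompactSupport (Function.uncurry fun t₂ t₁ ↦ Φ t₁ t₂) := by
  have : (Function.uncurry fun t₂ t₁ ↦ Φ t₁ t₂) = Function.uncurry Φ ∘ (Homeomorph.prodComm ℝ ℝ) := by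
    funext p; rfl
  rw [this]
  exact hΦc.comp_homeomorph _

/-- `fourier2 Φ ξ₁ ξ₂` is the transform in `t₂` of the partial transform `t₂ ↦ 𝓕(Φ(·,t₂))(ξ₁)`. [folklore] -/
theorem fourier2_eq_fourier_sliceFourier_swap {R : ℝ} (hbox : BoxSupport Φ R) (hc : Continuous (Function.uncurry Φ))
    (ξ₁ ξ₂ : ℝ) :
    fourier2 Φ ξ₁ ξ₂ = 𝓕 (sliceFourier (fun t₂ t₁ ↦ Φ t₁ t₂) ξ₁) ξ₂ := by
  rw [fourier2_eq_swap hbox hc, fourier_eq_integral_ker]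
  rfl

/-- **Complete `s`-sums of the box transform re-discretise the second variable**: for `uncurry Φ` smooth of compact
support, `h ≥ 1`, `τ, ξ₁ ∈ ℝ`:
`Σ_{s∈ℤ} fourier2 Φ ξ₁ (s/h + τ) = h·Σ_{k∈ℤ} e(−τhk)·𝓕(t₁ ↦ Φ(t₁, hk))(ξ₁)`. [folklore] -/
theorem tsum_fourier2_shift_eq (hΦ : ContDiff ℝ ∞ (Function.uncurry Φ))
    (hΦc : HasCompactSupport (Function.uncurry Φ)) {h : ℕ} (hh : 0 < h) (τ ξ₁ : ℝ) :
    ∑' s : ℤ, fourier2 Φ ξ₁ ((s : ℝ) / h + τ) =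
      (h : ℂ) * ∑' k : ℤ, (𝐞 (-(τ * (h * k))) : ℂ) * 𝓕 (fun t₁ : ℝ ↦ Φ t₁ (h * k)) ξ₁ := by
  obtain ⟨R, C₁, hR, hbox, hc, hs₁, hs₂, hC⟩ := poissonHypotheses_of_contDiff hΦ hΦc
  obtain ⟨R', C₁', hR', hbox', hc', hs₁', hs₂', hC'⟩ :=
    poissonHypotheses_of_contDiff (contDiff_uncurry_swap hΦ) (hasCompactSupport_uncurry_swap hΦc)
  simp_rw [fourier2_eq_fourier_sliceFourier_swap hbox hc]
  exact tsum_fourier_shift_eq (continuous_sliceFourier hbox' hc' ξ₁) (hasCompactSupport_sliceFourier hbox' ξ₁)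
    (fourier_sliceFourier_isBigO hbox' hc' hR' hs₁' hC' ξ₁) hh τ

/-- **The complete `s`-sum VANISHES when the modulus exceeds the box**: if `Φ(t₁,t₂) ≠ 0` forces `0 < t₂ < h`
(e.g. a dyadic box weight in the second variable with `2K₂ < h`), then `Σ_{s∈ℤ} fourier2 Φ ξ₁ (s/h + τ) = 0` — no
lattice point `kh` meets the support. G1 §4 (v): «`Σ_s Φ_c = 0`». [folklore] -/
theorem tsum_fourier2_shift_eq_zero (hΦ : ContDiff ℝ ∞ (Function.uncurry Φ))
    (hΦc : HasCompactSupport (Function.uncurry Φ)) {h : ℕ} (hh : 0 < h)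
    (hsupp : ∀ t₁ t₂, Φ t₁ t₂ ≠ 0 → 0 < t₂ ∧ t₂ < h) (τ ξ₁ : ℝ) :
    ∑' s : ℤ, fourier2 Φ ξ₁ ((s : ℝ) / h + τ) = 0 := by
  rw [tsum_fourier2_shift_eq hΦ hΦc hh]
  have hhr : (0 : ℝ) < h := by exact_mod_cast hh
  have hzero : ∀ k : ℤ, (fun t₁ : ℝ ↦ Φ t₁ (h * k)) = fun _ ↦ 0 := by
    intro k
    funext t₁
    by_contra hne
    obtain ⟨h1, h2⟩ := hsupp t₁ _ hne
    have hk0 : (0 : ℝ) < k := (mul_pos_iff_of_pos_left hhr).mp h1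
    have hk1 : (k : ℝ) < 1 := by
      have : (h : ℝ) * k < h * 1 := by rwa [mul_one]
      exact lt_of_mul_lt_mul_left this hhr.le
    have hk0' : (0 : ℤ) < k := by exact_mod_cast hk0
    have hk1' : k < (1 : ℤ) := by exact_mod_cast hk1
    omega
  have hF0 : ∀ k : ℤ, 𝓕 (fun t₁ : ℝ ↦ Φ t₁ (h * k)) ξ₁ = 0 := by
    intro k
    rw [hzero k, fourier_eq_integral_ker]
    simp
  simp [hF0]

end TwoDim

end Summit.Parity.GeneralizedHardyLittlewood.Theorems.BeyondDiagonalBeatsQuarter.OffDiag
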